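import Literature.NumberTheory.Transcendental.ManyCurveTheta
import Literature.NumberTheory.Transcendental.PkappaThetaCosetHilbert
import HarnessLib

/-!
# Lower bound for the Hilbert function of cosets of algebraic subgroups: `k`-lattice theta model

Topic `Literature/NumberTheory/Transcendental`; unit
`provefact-Literature.NumberTheory.Transcendental.H-0a3eb64689` (fact
`Literature.NumberTheory.Transcendental.HuberWustholzManyCurvePeriods`, `ManyCurvePeriods.lean`).
It introduces NO named fact. Lattice-family counterpart of the two-lattice
`TwoCurveThetaCosets.lean` (port of the model-level part of `PkappaThetaCosetHilbert.lean` and of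
`offDiv` from `PkappaThetaHilbert.lean`): for the theta model of `M = 𝔾ₘ^β × P` of
`ManyCurveTheta.lean` with BLOCKWISE lattices `Λ_{cls b}` (lattice family `L : 𝓙 → PeriodPair`,
class map `cls : γ → 𝓙`), for every connected algebraic subgroup datum `K` — here in the
one-lattice SHAPE `GaGmE.Std.SubgroupDataC β γ δ κM` on the block index `γ` (the family data
`GaGmEFam.Std.SubgroupDataC` have `K.tangent = K.toOne.tangent` by definition, so this covers
them) —, every `w₀` and every `t`:

* `exists_linearIndependent_thetaEval_coset` — `binom(t + m, m)` forms of degree `t`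
  (`m = dim K.tangent`) whose pull-backs `w ↦ F_P(w₀ + w)` to `Lie G'` are linearly independent,
  i.e. `H(𝔍(w₀ + G'); t) ≥ binom(t + m, m)` (Roy, LNM 1752 Ch. 11, Prop. 2.3 / p. 221).

Same proof as the one-lattice file (degenerate coordinates and the chart `J*`, the coordinate
functions `vals` as theta ratios, realisation of every point of a value grid at a good point of
the coset — the grid of the free `E`-coordinates now avoids `⋃_b Λ_{cls b}`, and `℘` is taken with the
lattice of the block —, Combinatorial Nullstellensatz); the generic lemmas (`exists_grid_avoiding`,
`countable_fibre_weierstrassP`, `degLE`, `card_degLE`, the block decomposition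
`SubgroupDataC.TY/TZ/TS/finrank_tangent`, `valSet`, …) are reused verbatim. Also: `offDiv`,
`mem_offDiv`, `dense_offDiv` for blockwise lattices.

## References

* Yu. V. Nesterenko, P. Philippon (eds.), *Introduction to Algebraic Independence Theory*,
  LNM 1752, Springer 2001, Ch. 11 (D. Roy): §2.2, Prop. 2.3, Thm. 4.1 (p. 221).
  [NesterenkoPhilippon2001]
* P. Philippon, *Lemmes de zéros dans les groupes algébriques commutatifs*, Bull. Soc. Math.
  France 114 (1986), 355–383, Thm. 2.1, §3. [Philippon1986]
* N. Alon, *Combinatorial Nullstellensatz*, Combin. Probab. Comput. 8 (1999), 7–29, Thm. 1.2.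
  [Alon1999]
* A. Huber, G. Wüstholz, *Transcendence and Linear Relations of 1-Periods*, CUP 2022, Thm. 15.3.
  [HuberWustholz2022]
-/

noncomputable section

open Complex MvPolynomial Module Filter Topology
open scoped PeriodPair

namespace Literature.NumberTheory.Transcendental

namespace GaGmEFam

namespace Std

open GaGmE (Kbar)
open GaGmE.Std (iy iz is coords coords_iy coords_iz coords_is ThetaIdx thetaT thetaT_none thetaT_some
  countable_fibre_weierstrassP exists_grid_avoiding degLE mem_degLE_iff card_degLE coe_symm_apply coe_symm_eq_sum
  apply_eq_zero_of_row_eq_zero valSet card_valSet ne_zero_of_mem_valSet Idx countable_lattice)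
open GaGmE.Std.SubgroupDataC (TY TZ TS mem_TY_iff mem_TZ_iff mem_TS_iff coords_mem_tangent_iff tangentEquiv
  finrank_tangent)

variable {𝓙 : Type} [DecidableEq 𝓙] {β γ δ : Type} [Fintype β] [Fintype γ] [Fintype δ] [DecidableEq γ]
variable (L : 𝓙 → PeriodPair) (cls : γ → 𝓙) {κM : δ → γ → Kbar}

/-! ### Off the divisors -/

omit [Fintype β] [Fintype γ] [Fintype δ] [DecidableEq γ] in
omit [DecidableEq 𝓙] in
/-- The lattice of a block lies in the union of the lattices of the blocks. [folklore] -/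
theorem lat_lattice_subset_union (b : γ) :
    ((L (cls b)).lattice : Set ℂ) ⊆ ⋃ b' : γ, ((L (cls b')).lattice : Set ℂ) :=
  Set.subset_iUnion (fun b' : γ => ((L (cls b')).lattice : Set ℂ)) b

variable (β δ) in
/-- The set of `w ∈ Lie M_ℂ` off the divisors `z'_b ∈ Λ_b` (blockwise lattices). [folklore] -/
def offDiv : Set (β ⊕ (γ ⊕ δ) → ℂ) :=
  {w | ∀ b : γ, w (iz b) ∉ (L (cls b)).lattice}

omit [Fintype β] [Fintype γ] [Fintype δ] [DecidableEq γ] in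
omit [DecidableEq 𝓙] in
/-- Membership in `offDiv`. [folklore] -/
theorem mem_offDiv {w : β ⊕ (γ ⊕ δ) → ℂ} :
    w ∈ offDiv β δ L cls ↔ ∀ b : γ, w (iz b) ∉ (L (cls b)).lattice :=
  Iff.rfl

omit [Fintype β] [Fintype γ] [Fintype δ] [DecidableEq γ] in
omit [DecidableEq 𝓙] in
/-- `offDiv` is dense in `Lie M_ℂ`. [folklore] -/
theorem dense_offDiv : Dense (offDiv β δ L cls (γ := γ)) := by
  have hΛ : ∀ b : γ, Dense (((L (cls b)).lattice : Set ℂ)ᶜ) := fun b =>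
    (countable_lattice (L (cls b))).dense_compl ℂ
  have heq : offDiv β δ L cls (γ := γ) = Set.pi Set.univ (fun i : β ⊕ (γ ⊕ δ) =>
      Sum.elim (fun _ => (Set.univ : Set ℂ))
        (Sum.elim (fun b => (((L (cls b)).lattice : Set ℂ))ᶜ) fun _ => Set.univ) i) := by
    ext w
    simp only [Set.mem_pi, Set.mem_univ, true_implies]
    constructor
    · intro h i
      rcases i with _ | b | _
      · exact Set.mem_univ _
      · exact h b
      · exact Set.mem_univ _
    · intro h b
      exact h (iz b)
  rw [heq]
  refine dense_pi Set.univ fun i _ => ?_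
  rcases i with _ | b | _
  · exact dense_univ
  · exact hΛ b
  · exact dense_univ

/-! ### Cosets `w₀ + Lie G'`: degenerate `E`-coordinates and the chart -/

variable (K : GaGmE.Std.SubgroupDataC β γ δ κM) (w₀ : β ⊕ (γ ⊕ δ) → ℂ)

/-- The **degenerate `E`-coordinates** of the coset `w₀ + Lie G'`: those `z'_b` that are constant
on it with a value in the lattice (then `σ(z'_b) ≡ 0` on the coset and the chart must use the
block `P₂ = σ³℘′`, which is `≠ 0` over the lattice). [folklore] -/
def degenerate : Set γ :=
  {b | (∀ z ∈ K.TZ, (z : γ → ℂ) b = 0) ∧ w₀ (iz b) ∈ (L (cls b)).lattice}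

open Classical in
/-- **The chart of the coset**: block index `2` on the degenerate `E`-coordinates, `0` elsewhere.
[folklore] -/
def chart : γ → Fin 3 := fun b => if b ∈ degenerate L cls K w₀ then 2 else 0

omit [DecidableEq γ] in
omit [DecidableEq 𝓙] in
/-- The chart on a degenerate coordinate. [folklore] -/
theorem chart_of_degenerate {b : γ} (h : b ∈ degenerate L cls K w₀) : chart L cls K w₀ b = 2 := by
  simp [chart, h]

omit [DecidableEq γ] in
omit [DecidableEq 𝓙] in
/-- The chart on a non-degenerate coordinate. [folklore] -/
theorem chart_of_not_degenerate {b : γ} (h : b ∉ degenerate L cls K w₀) : chart L cls K w₀ b = 0 := by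
  simp [chart, h]

/-- **The good points** of `Lie M_κ,ℂ` for the coset: the degenerate `E`-coordinates are in the
lattice and the other ones are off it (a dense condition on the coset). [folklore] -/
def good : Set (β ⊕ (γ ⊕ δ) → ℂ) :=
  {w' | ∀ b, (b ∈ degenerate L cls K w₀ → w' (iz b) ∈ (L (cls b)).lattice) ∧
    (b ∉ degenerate L cls K w₀ → w' (iz b) ∉ (L (cls b)).lattice)}

omit [DecidableEq γ] in
omit [DecidableEq 𝓙] in
/-- At a good point every block of the chart is non-zero. [folklore] -/
theorem univExtP_chart_ne_zero {w' : β ⊕ (γ ⊕ δ) → ℂ} (hw : w' ∈ good L cls K w₀) (b : γ) :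
    (L (cls b)).univExtP (chart L cls K w₀ b) (w' (iz b)) ≠ 0 := by
  by_cases hb : b ∈ degenerate L cls K w₀
  · rw [chart_of_degenerate L cls K w₀ hb]
    obtain ⟨m, n, h⟩ := PeriodPair.mem_lattice.mp ((hw b).1 hb)
    obtain ⟨c, hc, -, -, h2, -⟩ := (L (cls b)).exists_univExtTheta_lattice m n 0
    simp only [PeriodPair.univExtTheta_inl] at h2
    rw [← h, h2]
    exact mul_ne_zero hc (by norm_num)
  · rw [chart_of_not_degenerate L cls K w₀ hb, (PeriodPair.univExtP_eq ((hw b).2 hb)).1]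
    exact pow_ne_zero _ ((L (cls b)).weierstrassSigma_ne_zero ((hw b).2 hb))

/-- The base index `J* = (none, (chart, none))` of the coset: `Θ_{J*} = ∏_b P_{chart b}(z'_b)`.
[folklore] -/
def Jstar : Option β × ThetaIdx γ δ := (none, (chart L cls K w₀, none))

omit [DecidableEq 𝓙] in
/-- **`Θ_{J*} ≠ 0` at the good points of the coset.** [folklore] -/
theorem theta_Jstar_ne_zero {w' : β ⊕ (γ ⊕ δ) → ℂ} (hw : w' ∈ good L cls K w₀) :
    theta L cls κM (Jstar L cls K w₀) w' ≠ 0 := by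
  simp only [Jstar, theta, thetaT_none, thetaP_none, one_mul, thetaPnone]
  exact Finset.prod_ne_zero_iff.mpr fun b _ => univExtP_chart_ne_zero L cls K w₀ hw b

/-! ### The coordinate functions of the coset as theta ratios -/

variable (Fy : Finset β) (Fz : Finset γ) (Fs : Finset δ)

/-- The theta indices of the coordinate functions: `(j, (chart, none))` (`↦ e^{y'_j} Θ_{J*}`),
`(none, (chart[b ↦ 1], none))` (`↦ ℘(z'_b) Θ_{J*}`), `(none, (chart, e))` (`↦ ν_e Θ_{J*}`).
[folklore] -/
def Jmap : Idx Fy Fz Fs → Option β × ThetaIdx γ δ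
  | Sum.inl j => (some j.1, (chart L cls K w₀, none))
  | Sum.inr (Sum.inl b) => (none, (Function.update (chart L cls K w₀) b.1 1, none))
  | Sum.inr (Sum.inr e) => (none, (chart L cls K w₀, some e.1))

/-- **The coordinate functions** `Θ_{J(i)}/Θ_{J*}` of the coset (`e^{y'_j}`, `℘(z'_b)`,
`s_e - ∑_b κ_{eb} Z_{chart b}(z'_b)/P_{chart b}(z'_b)` at good points). [folklore] -/
def vals (w' : β ⊕ (γ ⊕ δ) → ℂ) (i : Idx Fy Fz Fs) : ℂ :=
  theta L cls κM (Jmap L cls K w₀ Fy Fz Fs i) w' / theta L cls κM (Jstar L cls K w₀) w'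

/-- **Homogenisation**: the exponent of the theta monomial `∏_i X_{J(i)}^{μ_i} · X_{J*}^{t - |μ|}`
of degree `t` attached to `μ ∈ ℕ^ι`, `|μ| ≤ t`. [folklore] -/
def expo (t : ℕ) (μ : Idx Fy Fz Fs →₀ ℕ) : (Option β × ThetaIdx γ δ) →₀ ℕ :=
  μ.mapDomain (Jmap L cls K w₀ Fy Fz Fs) + Finsupp.single (Jstar L cls K w₀) (t - μ.degree)

omit [DecidableEq 𝓙] in
/-- The theta monomial attached to `μ`, `|μ| ≤ t`, is a form of degree `t`. [folklore] -/
theorem isHomogeneous_monomial_expo {t : ℕ} {μ : Idx Fy Fz Fs →₀ ℕ} (hμ : μ.degree ≤ t) :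
    (monomial (expo L cls K w₀ Fy Fz Fs t μ) (1 : ℂ)).IsHomogeneous t := by
  refine isHomogeneous_monomial _ ?_
  rw [expo, map_add, Finsupp.degree_mapDomain, Finsupp.degree_single]
  omega

omit [DecidableEq 𝓙] in
/-- **The evaluation identity**: at a good point `w'` of the coset,
`F_{X^{expo μ}}(w') = Θ_{J*}(w')^t · ∏_i vals_i(w')^{μ_i}`. [folklore] -/
theorem thetaEval_monomial_expo {t : ℕ} {μ : Idx Fy Fz Fs →₀ ℕ} (hμ : μ.degree ≤ t)
    {w' : β ⊕ (γ ⊕ δ) → ℂ} (hw : w' ∈ good L cls K w₀) :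
    thetaEval L cls κM (monomial (expo L cls K w₀ Fy Fz Fs t μ) 1) w' =
      theta L cls κM (Jstar L cls K w₀) w' ^ t * ∏ i, vals L cls K w₀ Fy Fz Fs w' i ^ μ i := by
  have hΘ := theta_Jstar_ne_zero L cls K w₀ (κM := κM) hw
  set Θ := theta L cls κM (Jstar L cls K w₀) w' with hΘdef
  have h0 : ∀ J : Option β × ThetaIdx γ δ, (fun (J : Option β × ThetaIdx γ δ) (e : ℕ) => theta L cls κM J w' ^ e) J 0 = 1 :=
    fun J => pow_zero _
  have hadd : ∀ (J : Option β × ThetaIdx γ δ) (e₁ e₂ : ℕ),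
      (fun (J : Option β × ThetaIdx γ δ) (e : ℕ) => theta L cls κM J w' ^ e) J (e₁ + e₂) =
        (fun (J : Option β × ThetaIdx γ δ) (e : ℕ) => theta L cls κM J w' ^ e) J e₁ *
          (fun (J : Option β × ThetaIdx γ δ) (e : ℕ) => theta L cls κM J w' ^ e) J e₂ :=
    fun J e₁ e₂ => pow_add _ _ _
  rw [thetaEval, eval_monomial, one_mul, expo, Finsupp.prod_add_index' h0 hadd,
    Finsupp.prod_mapDomain_index h0 hadd]
  rw [Finsupp.prod_single_index (h := fun J e => theta L cls κM J w' ^ e) (pow_zero _),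
    Finsupp.prod_fintype _ _ (fun i => pow_zero _)]
  -- `Θ_{J(i)} = vals_i · Θ_{J*}`
  have hval : ∀ i, theta L cls κM (Jmap L cls K w₀ Fy Fz Fs i) w' = vals L cls K w₀ Fy Fz Fs w' i * Θ := fun i => by
    rw [vals, div_mul_cancel₀ _ hΘ]
  simp only [hval, mul_pow, Finset.prod_mul_distrib, Finset.prod_pow_eq_pow_sum]
  rw [← hΘdef, ← Finsupp.degree_eq_sum]
  have key : Θ ^ (t - μ.degree) * Θ ^ μ.degree = Θ ^ t := by
    rw [← pow_add, Nat.sub_add_cancel hμ]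
  linear_combination (∏ x, vals L cls K w₀ Fy Fz Fs w' x ^ μ x) * key

/-! ### Free coordinates: reconstruction of a block from its free coordinates -/


/-! ### Realising prescribed values at good points of the coset -/

omit [DecidableEq 𝓙] in
/-- **Realisation.** Given free coordinates of the three blocks of `Lie G'` (linear isomorphisms
`T_Y ≅ ℂ^{F_y}`, `T_Z ≅ ℂ^{F_z}`, `T_S ≅ ℂ^{F_s}` by restriction of coordinates) and finite sets
`Zg b ⊆ ℂ` (`b ∈ F_z`) of values of the free `E`-coordinates such that on the grid `∏ Zg b` every
non-constant `E`-coordinate of the coset stays off the lattice, every value vector `a` with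
`a_j ≠ 0` (`j ∈ F_y`) and `a_b ∈ ℘(w₀,b + Zg b)` (`b ∈ F_z`) is the vector of coordinate functions
`vals` at a good point of the coset `w₀ + Lie G'`. [folklore] -/
theorem exists_good_vals_eq (ey : K.TY ≃ₗ[ℂ] (Fy → ℂ)) (hey : ∀ v j, ey v j = (v : β → ℂ) j)
    (ez : K.TZ ≃ₗ[ℂ] (Fz → ℂ)) (hez : ∀ v b, ez v b = (v : γ → ℂ) b)
    (es : K.TS ≃ₗ[ℂ] (Fs → ℂ)) (hes : ∀ v e, es v e = (v : δ → ℂ) e)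
    (Zg : Fz → Finset ℂ)
    (hZgood : ∀ x : Fz → ℂ, (∀ b, x b ∈ Zg b) → ∀ r : γ,
      (fun b => ((ez.symm (Pi.single b 1) : K.TZ) : γ → ℂ) r) ≠ 0 →
        w₀ (iz r) + ∑ b, ((ez.symm (Pi.single b 1) : K.TZ) : γ → ℂ) r * x b ∉ (L (cls r)).lattice)
    (a : Idx Fy Fz Fs → ℂ) (hay : ∀ j, a (Sum.inl j) ≠ 0)
    (haz : ∀ b, ∃ x ∈ Zg b, ℘[L (cls (b : γ))] (w₀ (iz b) + x) = a (Sum.inr (Sum.inl b))) :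
    ∃ w ∈ K.tangent, w₀ + w ∈ good L cls K w₀ ∧ vals L cls K w₀ Fy Fz Fs (κM := κM) (w₀ + w) = a := by
  classical
  choose x hxZ hxa using haz
  -- the three blocks
  let y : K.TY := ey.symm fun j => Complex.log (a (Sum.inl j)) - w₀ (iy j)
  let z : K.TZ := ez.symm x
  let zf : γ → ℂ := fun r => w₀ (iz r) + (z : γ → ℂ) r
  let φ : δ → ℂ := fun e => ∑ r, (κM e r : ℂ) *
    ((L (cls r)).univExtZ (chart L cls K w₀ r) (zf r) / (L (cls r)).univExtP (chart L cls K w₀ r) (zf r))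
  let sv : K.TS := es.symm fun e => a (Sum.inr (Sum.inr e)) + φ e - w₀ (is e)
  let w : β ⊕ (γ ⊕ δ) → ℂ := coords (y : β → ℂ) (z : γ → ℂ) (sv : δ → ℂ)
  have hw : w ∈ K.tangent := (K.coords_mem_tangent_iff _ _ _).mpr ⟨y.2, z.2, sv.2⟩
  have hwy : ∀ j, (w₀ + w) (iy j) = w₀ (iy j) + (y : β → ℂ) j := fun j => rfl
  have hwz : ∀ r, (w₀ + w) (iz r) = zf r := fun r => rfl
  have hws : ∀ e, (w₀ + w) (is e) = w₀ (is e) + (sv : δ → ℂ) e := fun e => rfl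
  -- the free coordinates of the blocks
  have hyF : ∀ j : Fy, (y : β → ℂ) j = Complex.log (a (Sum.inl j)) - w₀ (iy j) := fun j =>
    coe_symm_apply ey hey _ j
  have hzF : ∀ b : Fz, (z : γ → ℂ) b = x b := fun b => coe_symm_apply ez hez _ b
  have hsF : ∀ e : Fs, (sv : δ → ℂ) e = a (Sum.inr (Sum.inr e)) + φ e - w₀ (is e) := fun e =>
    coe_symm_apply es hes _ e
  -- free `E`-coordinates are not degenerate
  have hndeg : ∀ b : Fz, (b : γ) ∉ degenerate L cls K w₀ := fun b hb => by
    have h1 := hb.1 _ (ez.symm (Pi.single b 1)).2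
    rw [coe_symm_apply ez hez] at h1
    simp at h1
  -- the point is good
  have hgood : w₀ + w ∈ good L cls K w₀ := by
    intro r
    constructor
    · intro hr
      rw [hwz]
      show w₀ (iz r) + (z : γ → ℂ) r ∈ (L (cls r)).lattice
      rw [hr.1 _ z.2, add_zero]
      exact hr.2
    · intro hr
      rw [hwz]
      show w₀ (iz r) + (z : γ → ℂ) r ∉ (L (cls r)).lattice
      by_cases hrow : (fun b => ((ez.symm (Pi.single b 1) : K.TZ) : γ → ℂ) r) = 0
      · have hrow' : ∀ b, ((ez.symm (Pi.single b 1) : K.TZ) : γ → ℂ) r = 0 := fun b =>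
          congr_fun hrow b
        have hzr : ∀ v : K.TZ, (v : γ → ℂ) r = 0 := apply_eq_zero_of_row_eq_zero ez hrow'
        rw [hzr z, add_zero]
        intro hmem
        exact hr ⟨fun v hv => hzr ⟨v, hv⟩, hmem⟩
      · have := hZgood x hxZ r hrow
        rwa [← coe_symm_eq_sum ez x r] at this
  refine ⟨w, hw, hgood, ?_⟩
  -- the values
  have hP : ∀ r, (L (cls r)).univExtP (chart L cls K w₀ r) (zf r) ≠ 0 := fun r => by
    rw [← hwz]; exact univExtP_chart_ne_zero L cls K w₀ hgood r
  have hPi : thetaPnone (β := β) (δ := δ) L cls (chart L cls K w₀) (w₀ + w) ≠ 0 :=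
    Finset.prod_ne_zero_iff.mpr fun r _ => hP r
  funext i
  rcases i with j | b | e
  · -- `e^{y'_j}`
    simp only [vals, Jmap, Jstar, theta, thetaT_some, thetaT_none, thetaP_none, one_mul]
    rw [mul_div_assoc, div_self hPi, mul_one, hwy, hyF, add_sub_cancel, Complex.exp_log (hay j)]
  · -- `℘(z'_b)`
    have hb0 : chart L cls K w₀ b = 0 := chart_of_not_degenerate L cls K w₀ (hndeg b)
    have hbΛ : zf b ∉ (L (cls (b : γ))).lattice := by rw [← hwz]; exact (hgood b).2 (hndeg b)
    simp only [vals, Jmap, Jstar, theta, thetaT_none, thetaP_none, one_mul, thetaPnone]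
    have hupd : ∀ r, (L (cls r)).univExtP (Function.update (chart L cls K w₀) b 1 r) ((w₀ + w) (iz r)) =
        Function.update (fun r => (L (cls r)).univExtP (chart L cls K w₀ r) ((w₀ + w) (iz r))) (b : γ)
          ((L (cls (b : γ))).univExtP 1 ((w₀ + w) (iz b))) r := fun r => by
      by_cases hrb : r = b
      · subst hrb; simp
      · simp [Function.update_of_ne hrb]
    rw [Finset.prod_congr rfl fun r _ => hupd r, Finset.prod_update_of_mem (Finset.mem_univ _),
      Finset.prod_eq_mul_prod_sdiff_singleton_of_mem (Finset.mem_univ (b : γ))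
        (fun r => (L (cls r)).univExtP (chart L cls K w₀ r) ((w₀ + w) (iz r))),
      mul_div_mul_right _ _ (Finset.prod_ne_zero_iff.mpr fun r _ => by rw [hwz]; exact hP r),
      hb0, hwz, (PeriodPair.univExtP_eq hbΛ).1, (PeriodPair.univExtP_eq hbΛ).2.1,
      mul_div_cancel_left₀ _ (pow_ne_zero _ ((L (cls (b : γ))).weierstrassSigma_ne_zero hbΛ))]
    show ℘[L (cls (b : γ))] (w₀ (iz b) + (z : γ → ℂ) b) = a (Sum.inr (Sum.inl b))
    rw [hzF, hxa]
  · -- `ν_e` in the chart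
    simp only [vals, Jmap, Jstar, theta, thetaT_none, thetaP_none, thetaP_some, one_mul, thetaPsome]
    rw [sub_div, mul_div_assoc, div_self hPi, mul_one, Finset.sum_div]
    have hterm : ∀ r, (κM e r : ℂ) * ((L (cls r)).univExtZ (chart L cls K w₀ r) ((w₀ + w) (iz r)) *
        ∏ r' ∈ Finset.univ.erase r, (L (cls r')).univExtP (chart L cls K w₀ r') ((w₀ + w) (iz r'))) /
          thetaPnone (β := β) (δ := δ) L cls (chart L cls K w₀) (w₀ + w) =
        (κM e r : ℂ) * ((L (cls r)).univExtZ (chart L cls K w₀ r) (zf r) / (L (cls r)).univExtP (chart L cls K w₀ r) (zf r)) := by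
      intro r
      rw [thetaPnone, ← Finset.mul_prod_erase Finset.univ _ (Finset.mem_univ r), mul_div_assoc,
        mul_div_mul_right _ _ (Finset.prod_ne_zero_iff.mpr fun r' _ => by rw [hwz]; exact hP r'), hwz]
    rw [Finset.sum_congr rfl fun r _ => hterm r, hws, hsF]
    ring


/-! ### Linear independence from a grid of good points -/

omit [DecidableEq 𝓙] in
/-- **Independence from a grid.** If every point of a grid `∏_i A_i` with `#A_i = t + 1` is the
value vector `vals` of a good point of the coset, then the pull-backs to `Lie G'` of the theta
monomials `X^{expo μ}`, `|μ| ≤ t`, are linearly independent: a relation gives a polynomial of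
partial degrees `≤ t` in the free coordinates vanishing on the grid, hence zero by the
Combinatorial Nullstellensatz (`MvPolynomial.eq_zero_of_eval_zero_at_prod_finset`). [folklore] -/
theorem linearIndependent_thetaEval_of_grid {t : ℕ} (A : Idx Fy Fz Fs → Finset ℂ)
    (hAcard : ∀ i, (A i).card = t + 1)
    (hreal : ∀ a : Idx Fy Fz Fs → ℂ, (∀ i, a i ∈ A i) →
      ∃ w ∈ K.tangent, w₀ + w ∈ good L cls K w₀ ∧ vals L cls K w₀ Fy Fz Fs (κM := κM) (w₀ + w) = a) :
    LinearIndependent ℂ fun μ : ↥(degLE (Idx Fy Fz Fs) t) => fun w : K.tangent =>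
      thetaEval L cls κM (monomial (expo L cls K w₀ Fy Fz Fs t μ.1) (1 : ℂ)) (w₀ + w) := by
  classical
  rw [Fintype.linearIndependent_iff]
  intro c hc μ₀
  -- the polynomial `R = ∑ c_μ X^μ` in the free coordinates vanishes on the grid
  set R : MvPolynomial (Idx Fy Fz Fs) ℂ := ∑ μ : ↥(degLE (Idx Fy Fz Fs) t), monomial μ.1 (c μ)
    with hRdef
  have hReval : ∀ a : Idx Fy Fz Fs → ℂ, (∀ i, a i ∈ A i) → eval a R = 0 := by
    intro a ha
    obtain ⟨w, hw, hgood, hvals⟩ := hreal a ha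
    have h1 := congr_fun hc ⟨w, hw⟩
    simp only [Finset.sum_apply, Pi.smul_apply, smul_eq_mul, Pi.zero_apply] at h1
    have h2 : ∀ μ : ↥(degLE (Idx Fy Fz Fs) t),
        thetaEval L cls κM (monomial (expo L cls K w₀ Fy Fz Fs t μ.1) (1 : ℂ)) (w₀ + w) =
          theta L cls κM (Jstar L cls K w₀) (w₀ + w) ^ t * ∏ i, a i ^ (μ.1 : Idx Fy Fz Fs →₀ ℕ) i := by
      intro μ
      rw [thetaEval_monomial_expo L cls K w₀ Fy Fz Fs (mem_degLE_iff.mp μ.2) hgood, hvals]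
    have h1' : theta L cls κM (Jstar L cls K w₀) (w₀ + w) ^ t *
        ∑ μ : ↥(degLE (Idx Fy Fz Fs) t), c μ * ∏ i, a i ^ (μ.1 : Idx Fy Fz Fs →₀ ℕ) i = 0 := by
      rw [← h1, Finset.mul_sum]
      refine Finset.sum_congr rfl fun μ _ => ?_
      rw [h2 μ]
      ring
    have h3 : ∑ μ : ↥(degLE (Idx Fy Fz Fs) t), c μ * ∏ i, a i ^ (μ.1 : Idx Fy Fz Fs →₀ ℕ) i = 0 :=
      (mul_eq_zero.mp h1').resolve_left (pow_ne_zero _ (theta_Jstar_ne_zero L cls K w₀ hgood))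
    rw [← h3, hRdef, map_sum]
    refine Finset.sum_congr rfl fun μ _ => ?_
    rw [eval_monomial, Finsupp.prod_fintype _ _ fun i => pow_zero _]
  -- hence `R = 0` (Alon's Nullstellensatz: all partial degrees are `≤ t < t + 1`)
  have hRdeg : R.totalDegree ≤ t := by
    refine (totalDegree_finsetSum _ _).trans (Finset.sup_le fun μ _ => ?_)
    refine (totalDegree_monomial_le _ _).trans ?_
    have := mem_degLE_iff.mp μ.2
    rw [Finsupp.degree_eq_sum] at this
    rw [Finsupp.sum_fintype _ _ (fun _ => rfl)]
    simpa using this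
  have hR : R = 0 :=
    eq_zero_of_eval_zero_at_prod_finset R A
      (fun i => by rw [hAcard]; exact Nat.lt_succ_of_le ((degreeOf_le_totalDegree R i).trans hRdeg))
      hReval
  -- and `c_{μ₀}` is a coefficient of `R`
  have hcoeff : coeff μ₀.1 R = c μ₀ := by
    rw [hRdef, coeff_sum, Finset.sum_eq_single μ₀]
    · simp
    · intro μ _ hne
      rw [coeff_monomial, if_neg fun h => hne (Subtype.ext h)]
    · intro h
      exact absurd (Finset.mem_univ μ₀) h
  rw [← hcoeff, hR, coeff_zero]

/-- The value grid: `1, …, t + 1` for the torus and fibre coordinates, `℘(w₀,b + Zg b)` for the free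
`E`-coordinates. [folklore] -/
def gridSets (t : ℕ) (Zg : ↥Fz → Finset ℂ) : Idx Fy Fz Fs → Finset ℂ
  | Sum.inl _ => valSet t
  | Sum.inr (Sum.inl b) => (Zg b).image fun x => ℘[L (cls (b : γ))] (w₀ (iz b) + x)
  | Sum.inr (Sum.inr _) => valSet t

/-! ### The theorem -/

omit [DecidableEq 𝓙] in
/-- **Lower bound for the Hilbert function of a coset of an algebraic subgroup (theta model).**
For a connected algebraic subgroup `G'` of `M_κ,ℂ` (`K : SubgroupDataC`, `Lie G' = K.tangent`,
`m = dim Lie G'`), a point `w₀ ∈ Lie M_κ,ℂ` and a degree `t`, there are `binom(t + m, m)` forms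
`P_k` of degree `t` in the theta functions whose pull-backs `F_{P_k}(w₀ + ·) = P_k(Θ(w₀ + ·))`
to `Lie G'` are `ℂ`-linearly independent. Equivalently, the ideal `𝔭 = 𝔍(w₀ + G')` of the
translate `exp(w₀) + G' ⊂ M_κ ⊂ ℙ^N` satisfies `H(𝔭; t) ≥ binom(t + m, m) ≥ t^m / m!` for all
`t` — the lower bound `ℋ(H₀; D) ≥ D^{dim H₀}` (`deg H₀ ≥ 1`) for the translates `σ + H₀` on the
left-hand side of Philippon's zero estimate (Roy's Prop. 2.3 and Thm. 4.1; for `𝔾ₐ × 𝔾ₘⁿ` the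
tree's `GaGmSubgroupDegrees.lean`), here for the theta model of `M_κ` and uniformly in `G'` and
`w₀`. [cite: NesterenkoPhilippon2001, Ch. 11 Prop. 2.3, Thm. 4.1 (ℋ(H₀; D) ≥ D^{n-δ}, p. 221)] -/
theorem exists_linearIndependent_thetaEval_coset (K : GaGmE.Std.SubgroupDataC β γ δ κM)
    (w₀ : β ⊕ (γ ⊕ δ) → ℂ) (t : ℕ) :
    ∃ (n : ℕ) (P : Fin n → MvPolynomial (Option β × ThetaIdx γ δ) ℂ),
      n = (t + finrank ℂ K.tangent).choose (finrank ℂ K.tangent) ∧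
      (∀ k, (P k).IsHomogeneous t) ∧
      LinearIndependent ℂ fun k => fun w : K.tangent => thetaEval L cls κM (P k) (w₀ + w) := by
  classical
  -- free coordinates of the three blocks
  obtain ⟨Fy, hFy, hby⟩ := K.TY.exists_finset_restrict_bijective
  obtain ⟨Fz, hFz, hbz⟩ := K.TZ.exists_finset_restrict_bijective
  obtain ⟨Fs, hFs, hbs⟩ := K.TS.exists_finset_restrict_bijective
  let fy : K.TY →ₗ[ℂ] (Fy → ℂ) := LinearMap.pi fun j : Fy => (LinearMap.proj (j : β)).comp K.TY.subtype
  let fz : K.TZ →ₗ[ℂ] (Fz → ℂ) := LinearMap.pi fun b : Fz => (LinearMap.proj (b : γ)).comp K.TZ.subtype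
  let fs : K.TS →ₗ[ℂ] (Fs → ℂ) := LinearMap.pi fun e : Fs => (LinearMap.proj (e : δ)).comp K.TS.subtype
  let ey : K.TY ≃ₗ[ℂ] (Fy → ℂ) := LinearEquiv.ofBijective fy hby
  let ez : K.TZ ≃ₗ[ℂ] (Fz → ℂ) := LinearEquiv.ofBijective fz hbz
  let es : K.TS ≃ₗ[ℂ] (Fs → ℂ) := LinearEquiv.ofBijective fs hbs
  have hey : ∀ v j, ey v j = (v : β → ℂ) j := fun _ _ => rfl
  have hez : ∀ v b, ez v b = (v : γ → ℂ) b := fun _ _ => rfl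
  have hes : ∀ v e, es v e = (v : δ → ℂ) e := fun _ _ => rfl
  -- the count
  have hcard : Fintype.card (Idx Fy Fz Fs) = finrank ℂ K.tangent := by
    rw [Fintype.card_sum, Fintype.card_sum, Fintype.card_coe, Fintype.card_coe, Fintype.card_coe,
      hFy, hFz, hFs, K.finrank_tangent, add_assoc]
  -- the grid of values of the free `E`-coordinates
  obtain ⟨Zg, hZgc, -, hZgi, hZgood'⟩ := exists_grid_avoiding (ρ := γ) (t + 1)
    (fun b : Fz => {x : ℂ | w₀ (iz b) + x ∈ (L (cls (b : γ))).lattice})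
    (fun b => (countable_lattice (L (cls (b : γ)))).preimage (add_right_injective (w₀ (iz (b : γ)))))
    (fun (b : Fz) (x : ℂ) => ℘[L (cls (b : γ))] (w₀ (iz b) + x))
    (fun b v => ((countable_fibre_weierstrassP (L (cls (b : γ))) v).preimage
      (add_right_injective (w₀ (iz (b : γ))))).mono fun x hx => And.intro hx.1 hx.2)
    (Set.countable_iUnion fun b : γ => countable_lattice (L (cls b))) (fun r => w₀ (iz r))
    (fun r b => ((ez.symm (Pi.single b 1) : K.TZ) : γ → ℂ) r)
  have hZgood : ∀ x : Fz → ℂ, (∀ b, x b ∈ Zg b) → ∀ r : γ,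
      (fun b => ((ez.symm (Pi.single b 1) : K.TZ) : γ → ℂ) r) ≠ 0 →
        w₀ (iz r) + ∑ b, ((ez.symm (Pi.single b 1) : K.TZ) : γ → ℂ) r * x b ∉ (L (cls r)).lattice :=
    fun x hx r hr h => hZgood' x hx r hr (lat_lattice_subset_union L cls r h)
  -- every grid point is realised at a good point of the coset
  have hAcard : ∀ i, (gridSets L cls w₀ Fy Fz Fs t Zg i).card = t + 1 := by
    rintro (j | b | e)
    · exact card_valSet t
    · show ((Zg b).image fun x => ℘[L (cls (b : γ))] (w₀ (iz b) + x)).card = t + 1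
      rw [Finset.card_image_of_injOn (hZgi b), hZgc]
    · exact card_valSet t
  have hreal : ∀ a : Idx Fy Fz Fs → ℂ, (∀ i, a i ∈ gridSets L cls w₀ Fy Fz Fs t Zg i) →
      ∃ w ∈ K.tangent, w₀ + w ∈ good L cls K w₀ ∧ vals L cls K w₀ Fy Fz Fs (κM := κM) (w₀ + w) = a := by
    intro a ha
    refine exists_good_vals_eq L cls K w₀ Fy Fz Fs ey hey ez hez es hes Zg hZgood a
      (fun j => ne_zero_of_mem_valSet (ha (Sum.inl j))) fun b => Finset.mem_image.mp (ha (Sum.inr (Sum.inl b)))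
  have hli := linearIndependent_thetaEval_of_grid L cls K w₀ Fy Fz Fs (κM := κM) _ hAcard hreal
  -- reindex by `Fin n`
  refine ⟨(degLE (Idx Fy Fz Fs) t).card,
    fun k => monomial (expo L cls K w₀ Fy Fz Fs t ((degLE (Idx Fy Fz Fs) t).equivFin.symm k).1) 1,
    ?_, fun k => isHomogeneous_monomial_expo L cls K w₀ Fy Fz Fs (mem_degLE_iff.mp (Subtype.prop _)), ?_⟩
  · rw [card_degLE, hcard]
  · exact hli.comp _ (degLE (Idx Fy Fz Fs) t).equivFin.symm.injective



end Std

end GaGmEFam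

end Literature.NumberTheory.Transcendental

end
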